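import Mathlib.Analysis.SpecialFunctions.Log.Basic
import Mathlib.Analysis.SpecialFunctions.Sqrt
import Literature.Probability.LatticeModels.ONModel
import HarnessLib

/-!
# Long-range order of the classical XY model in `d ≥ 3` without reflection positivity
# (Garban–Spencer 2022, Thm. 1.3 with Remark 1)

C. Garban, T. Spencer, *Continuous symmetry breaking along the Nishimori line*, J. Math. Phys.
**63** (2022) 093302 = arXiv:2109.01617.  Theorem 1.3 there is a QUENCHED-AVERAGED lower bound
`𝔼[⟨cos(θ(x) − θ(y))⟩_{ω,ψ,β,h,Λ}] ≥ 1 − √(a log β / β)` for the XY model in Nishimori disorder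
(`u ≡ β`), valid for `d ≥ 3`, all `β ≥ β*`, all random fields `h`, ALL finite `Λ ⊂ ℤ^d` with free
boundary conditions and all `x, y ∈ Λ` with `B((x+y)/2, 2‖x−y‖₂) ⊂ Λ`; Remark 1 (with the
Messager–Miracle-Solé–Pfister correlation inequality proved in the paper's Appendix) transfers it at
`h = 0` to the model WITHOUT disorder: `⟨cos(θ(x) − θ(y))⟩_{ω=0,β,Λ} ≥ ⟨cos(θ(x) − θ(y))⟩_{ω,β,Λ}`
for every disorder `ω`, "hence Theorem 1.3 implies long range order without disorder".  The proof
uses no reflection positivity and no translation invariance (group synchronisation along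
unpredictable paths, Abbe–Massoulié–Montanari–Sly–Srivastava 2018), which is why it holds on
arbitrary finite domains; the paper records (Remark 14) that it extends verbatim to inhomogeneous
couplings `J_{ij} ≥ J > 0` and (Remark 10) to the Villain interaction — those two extensions are
REMARKS in the source and are deliberately NOT vendored here.

This file vendors exactly the disorder-free corollary (Thm. 1.3 ∘ Remark 1) over the tree's
classical `O(N)` vocabulary (`Literature/Probability/LatticeModels/ONModel.lean`, `N = 2`:
spins on the unit circle of `ℝ²` with the uniform a priori measure, Gibbs weight
`exp(β Σ_{{i,j} ⊂ Λ, i∼j} ⟪s_i, s_j⟫)` = `exp(β Σ cos(θ_i − θ_j))`, free boundary condition = only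
edges inside `Λ`, which is the paper's (1.1); `onTwoPoint μ x y = ∫ ⟪s_x, s_y⟫ dμ = ⟨cos(θ(x) − θ(y))⟩`),
on the nearest-neighbour graph `zdGraph d` of `ℤ^d = Site d`.  The ball condition is rendered with the
CLOSED Euclidean ball (every lattice point `z` with `‖z − (x+y)/2‖₂ ≤ 2‖x − y‖₂` lies in `Λ`), which
is implied by either reading of the printed `B(·,·) ⊂ Λ`.

It grounds (as nearest print, not as a match) the Villain-current engine items
`Summit.AtomisticToContinuum.BoseEinsteinCondensation.Theses.BECStoquasticCensoring.VillainCurrentLRO`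
and `.HomogeneousVillainLRO` (equal-time long-range order of the worm two-point function of the
(3+1)-D Villain current model, uniformly in inhomogeneous elliptic stiffnesses): those differ from
this fact by (i) Villain instead of cosine interaction (Remark 10), (ii) bondwise stiffnesses in
`[K_i, ΛK_i]` (Remark 14 / Ginibre comparison — the tree proves Ginibre's inequality for cosine
interactions, `ginibreExpect_reChar_mono`), (iii) the space-time TORUS instead of a free box
(torus ⊇ free box by Ginibre), and (iv) the current (dual) representation of the two-point
function (Fröhlich–Spencer 1982 §2; `VillainCurrentModel.lean`), none of which is in print as a
theorem.

Mathlib / tree search (2026-08-15): Mathlib has no XY/O(N) model; the tree has the `O(N)` Gibbs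
measure (`onMeasure`, `onTwoPoint`), Ginibre's inequality for cosine models
(`GinibreInequality.lean`), the Ising infrared bound (`InfraredBound.lean`, `GaussianDomination.lean`)
and the quantum-rotor / quantum-XY LRO facts (`KleinPerez1992_rotorGroundStateLRO`,
`kennedy_lieb_shastry_xy_*`); no classical XY / Villain long-range-order statement existed.

## References
* C. Garban, T. Spencer, J. Math. Phys. 63 (2022) 093302, arXiv:2109.01617: Thm. 1.3, Remark 1,
  Remarks 10 and 14, Appendix (Messager–Miracle-Solé–Pfister). [GarbanSpencer2022]
* J. Fröhlich, B. Simon, T. Spencer, Comm. Math. Phys. 50 (1976) 79–95 (the reflection-positivity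
  proof on even tori, for comparison). [FrohlichSimonSpencer1976]
-/

noncomputable section

namespace Literature.Probability.LatticeModels

open MeasureTheory

/-- NAMED FACT — **Garban–Spencer 2022, Theorem 1.3 with Remark 1 (long-range order of the
classical XY model in `d ≥ 3`, free boundary conditions, arbitrary finite domains).**
"Let `d ≥ 3`. There exist constants `β*, a > 0` such that for all `β ≥ β*`, all magnetic fields
`h = {h_j}`, all finite `Λ ⊂ ℤ^d` and all points `x, y ∈ Λ` s.t. `B((x+y)/2, 2‖x−y‖₂) ⊂ Λ`,
`𝔼^{XY}_{β,h}[⟨cos(θ(x) − θ(y))⟩_{ω,ψ,β,h,Λ}] ≥ 1 − √(a log β / β)`" (Thm. 1.3), and "By the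
correlation inequality of [Messager–Miracle-Solé–Pfister] (see Appendix) when `h = 0`,
`⟨cos(θ(x) − θ(y))⟩_{ω=0,β,Λ} ≥ ⟨cos(θ(x) − θ(y))⟩_{ω,β,Λ}`, hence Theorem 1.3 implies long range
order without disorder" (Remark 1).  Vendored: the resulting bound for the pure nearest-neighbour
XY model `exp(β Σ_{i∼j ⊂ Λ} cos(θ_i − θ_j)) ∏ dθ_i` ((1.1) of the source) on any finite
`Λ ⊂ ℤ^d`, as the `N = 2` case of the tree's `O(N)` model with free boundary condition; the ball is
the closed Euclidean ball intersected with `ℤ^d`.  Grounds (nearest print only — see the module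
docstring for the four differences) `Summit.AtomisticToContinuum.BoseEinsteinCondensation.Theses.BECStoquasticCensoring.VillainCurrentLRO`
and `Summit.AtomisticToContinuum.BoseEinsteinCondensation.Theses.BECStoquasticCensoring.HomogeneousVillainLRO`.
[cite: GarbanSpencer2022, Thm. 1.3 with Remark 1 and Appendix] -/
def GarbanSpencer2022_xyLongRangeOrder : Prop :=
  ∀ d : ℕ, 3 ≤ d → ∃ βc a : ℝ, 0 < βc ∧ 0 < a ∧ ∀ β : ℝ, βc ≤ β →
    ∀ (Λ : Finset (Site d)) (x y : Site d), x ∈ Λ → y ∈ Λ →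
      (∀ z : Site d,
        (∑ i, ((z i : ℝ) - ((x i : ℝ) + (y i : ℝ)) / 2) ^ 2) ≤ 4 * ∑ i, ((x i : ℝ) - (y i : ℝ)) ^ 2 →
          z ∈ Λ) →
      1 - Real.sqrt (a * Real.log β / β) ≤
        onTwoPoint (onMeasure (N := 2) (zdGraph d) Λ β ONBoundary.free) x y

end Literature.Probability.LatticeModels

end
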